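import Summits.RiemannHypothesis.RiemannHypothesis.Theorems.LiPrimeEchoEdgeTerms
import HarnessLib

/-!
# RiemannHypothesis / LiPrimeEcho — crux K2 `LiPrimeEdgeEcho`, part 5: phase and amplitude of the resonant term (RH-FREE)

RH-FREE [rh-li-prover].  Route `Theses/LiPrimeEcho.lean` (rung «Li PRIME-ECHO LAW» `LiTheory.LiZeroWindowEcho`), item
`LiPrimeEdgeEcho` (stmt-RiemannHypothesis-19245).  Polar form of the resonant term on the edge `w = 3/2 + iy`:
with `z = (w − 1)/w = ((y² + 3/4) + iy)/(y² + 9/4)` one has `arg z = b(y) = arctan(y/(y² + 3/4))`,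
`−log |z| = h(y) = ½ log((y² + 9/4)/(y² + 1/4))`, hence

  `Λ(2) 2^{−w} z⁻ⁿ = g(y) e^{iP(y)}`,  `g = (log 2) 2^{−3/2} e^{n h}`,  `P = −y log 2 − n b`,

and the real calculus the stationary phase theorem consumes: `b' = −u`, `u = (y² − 3/4)/Q` (`Q = (y²+1/4)(y²+9/4)`),
`u' = u₁ = y/(y²+1/4)² − 3y/(y²+9/4)²`, `u₁' = u₂`, `h' = −2y/Q`; the bounds `1/(2y³) ≤ −u₁ ≤ 3/y³` (`y ≥ 3`),
`|u₂| ≤ 19/y⁴`, `0 ≤ h ≤ 1/y²`, and the asymptotics `|u − 1/y²| ≤ 4/y⁴`, `|h − u| ≤ 7/y⁴`, `|y³(−u₁) − 2| ≤ 30/y²`,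
`|b − 1/y| ≤ 2/y³`.  Nothing here bears on the truth of RH.
-/

noncomputable section

-- D-0017: `Summit.<S>.<S>.…` is the designed namespace of a single-problem summit.
set_option linter.dupNamespace false

open Complex MeasureTheory intervalIntegral Set
open scoped Real Interval ArithmeticFunction.vonMangoldt

namespace Summit.RiemannHypothesis.RiemannHypothesis.Theorems.LiTheory

namespace PrimeEdge

/-! ### The real functions -/

/-- `b(y) = arg z = arctan(y/(y² + 3/4))`. -/
def bq (y : ℝ) : ℝ := Real.arctan (y / (y ^ 2 + 3 / 4))

/-- `u(y) = (y² − 3/4)/Q = (3/2)/(y² + 9/4) − (1/2)/(y² + 1/4)` (`= −b'`). -/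
def ua (y : ℝ) : ℝ := 3 / 2 / (y ^ 2 + 9 / 4) - 1 / 2 / (y ^ 2 + 1 / 4)

/-- `u₁ = u' = y/(y² + 1/4)² − 3y/(y² + 9/4)²`. -/
def ub (y : ℝ) : ℝ := y / (y ^ 2 + 1 / 4) ^ 2 - 3 * y / (y ^ 2 + 9 / 4) ^ 2

/-- `u₂ = u₁' = (1/4 − 3y²)/(y² + 1/4)³ − 3(9/4 − 3y²)/(y² + 9/4)³`. -/
def uc (y : ℝ) : ℝ := (1 / 4 - 3 * y ^ 2) / (y ^ 2 + 1 / 4) ^ 3 - 3 * (9 / 4 - 3 * y ^ 2) / (y ^ 2 + 9 / 4) ^ 3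

/-- `h(y) = −log |z| = ½ log((y² + 9/4)/(y² + 1/4))`. -/
def ha (y : ℝ) : ℝ := 1 / 2 * Real.log ((y ^ 2 + 9 / 4) / (y ^ 2 + 1 / 4))

/-- `κ = Λ(2) 2^{−3/2} = (log 2)/2^{3/2}`. -/
def kap : ℝ := Real.log 2 * (2 : ℝ) ^ (-(3 / 2 : ℝ))

/-- The resonant amplitude `g(y) = κ e^{n h(y)}` (`= |Λ(2) 2^{−w} z⁻ⁿ|`). -/
def gA (n : ℕ) (y : ℝ) : ℝ := kap * Real.exp (n * ha y)

/-- The resonant phase `P(y) = −y log 2 − n b(y)` (`= arg(2^{−w} z⁻ⁿ)`). -/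
def Ph (n : ℕ) (y : ℝ) : ℝ := -(Real.log 2 * y) - n * bq y

/-- `u = (y² − 3/4)/Q`. -/
theorem ua_eq (y : ℝ) : ua y = (y ^ 2 - 3 / 4) / Qd y := by
  unfold ua Qd
  have h1 : (0 : ℝ) < y ^ 2 + 9 / 4 := by positivity
  have h2 : (0 : ℝ) < y ^ 2 + 1 / 4 := by positivity
  field_simp
  ring

/-- `κ > 0`. -/
theorem kap_pos : 0 < kap := by unfold kap; exact mul_pos (Real.log_pos (by norm_num)) (by positivity)

/-- `g > 0`. -/
theorem gA_pos (n : ℕ) (y : ℝ) : 0 < gA n y := mul_pos kap_pos (Real.exp_pos _)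

/-! ### Derivatives -/

/-- `b' = −u`. -/
theorem hasDerivAt_bq (y : ℝ) : HasDerivAt bq (-ua y) y := by
  have h34 : (0 : ℝ) < y ^ 2 + 3 / 4 := by positivity
  have hv : HasDerivAt (fun y : ℝ ↦ y / (y ^ 2 + 3 / 4)) ((1 * (y ^ 2 + 3 / 4) - y * (2 * y)) / (y ^ 2 + 3 / 4) ^ 2) y := by
    have hd : HasDerivAt (fun y : ℝ ↦ y ^ 2 + 3 / 4) (2 * y) y := by
      simpa using ((hasDerivAt_pow 2 y).add_const (3 / 4 : ℝ))
    exact (hasDerivAt_id' y).div hd h34.ne'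
  have h := hv.arctan
  refine h.congr_deriv ?_
  rw [ua_eq, Qd]
  field_simp
  ring

/-- `d/dy (y² + a)⁻¹ = −2y/(y² + a)²` (`a > 0`). -/
theorem hasDerivAt_inv_sq_add {a : ℝ} (ha : 0 < a) (y : ℝ) :
    HasDerivAt (fun y : ℝ ↦ (y ^ 2 + a)⁻¹) (-(2 * y) / (y ^ 2 + a) ^ 2) y := by
  have hd : HasDerivAt (fun y : ℝ ↦ y ^ 2 + a) (2 * y) y := by simpa using ((hasDerivAt_pow 2 y).add_const a)
  have hne : y ^ 2 + a ≠ 0 := by positivity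
  exact hd.inv hne

/-- `d/dy (y/(y² + a)²) = (a − 3y²)/(y² + a)³` (`a > 0`). -/
theorem hasDerivAt_div_sq_add_sq {a : ℝ} (ha : 0 < a) (y : ℝ) :
    HasDerivAt (fun y : ℝ ↦ y / (y ^ 2 + a) ^ 2) ((a - 3 * y ^ 2) / (y ^ 2 + a) ^ 3) y := by
  have h1 : HasDerivAt (fun y : ℝ ↦ y ^ 2 + a) (2 * y) y := by simpa using ((hasDerivAt_pow 2 y).add_const a)
  have hd : HasDerivAt (fun y : ℝ ↦ (y ^ 2 + a) ^ 2) (((2 : ℕ) : ℝ) * (y ^ 2 + a) ^ (2 - 1) * (2 * y)) y := h1.pow 2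
  have hne : (y ^ 2 + a) ^ 2 ≠ 0 := by positivity
  have h := (hasDerivAt_id' y).div hd hne
  refine h.congr_deriv ?_
  have hne' : y ^ 2 + a ≠ 0 := by positivity
  norm_num
  field_simp
  ring

/-- `u' = u₁`. -/
theorem hasDerivAt_ua (y : ℝ) : HasDerivAt ua (ub y) y := by
  have h1 := (hasDerivAt_inv_sq_add (by norm_num : (0 : ℝ) < 9 / 4) y).const_mul (3 / 2 : ℝ)
  have h2 := (hasDerivAt_inv_sq_add (by norm_num : (0 : ℝ) < 1 / 4) y).const_mul (1 / 2 : ℝ)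
  have h := h1.sub h2
  have e : ua = fun y : ℝ ↦ 3 / 2 * (y ^ 2 + 9 / 4)⁻¹ - 1 / 2 * (y ^ 2 + 1 / 4)⁻¹ := by
    funext y; simp only [ua, div_eq_mul_inv]
  rw [e]
  refine h.congr_deriv ?_
  rw [ub]
  have h9 : y ^ 2 + 9 / 4 ≠ 0 := by positivity
  have h4 : y ^ 2 + 1 / 4 ≠ 0 := by positivity
  field_simp
  ring

/-- `u₁' = u₂`. -/
theorem hasDerivAt_ub (y : ℝ) : HasDerivAt ub (uc y) y := by
  have h1 := hasDerivAt_div_sq_add_sq (by norm_num : (0 : ℝ) < 1 / 4) y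
  have h2 := (hasDerivAt_div_sq_add_sq (by norm_num : (0 : ℝ) < 9 / 4) y).const_mul (3 : ℝ)
  have h := h1.sub h2
  have e : ub = fun y : ℝ ↦ y / (y ^ 2 + 1 / 4) ^ 2 - 3 * (y / (y ^ 2 + 9 / 4) ^ 2) := by
    funext y; simp only [ub]; ring
  rw [e]
  refine h.congr_deriv ?_
  rw [uc]
  ring

/-- `h' = −2y/Q`. -/
theorem hasDerivAt_ha (y : ℝ) : HasDerivAt ha (-(2 * y / Qd y)) y := by
  have h9 : (0 : ℝ) < y ^ 2 + 9 / 4 := by positivity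
  have h4 : (0 : ℝ) < y ^ 2 + 1 / 4 := by positivity
  have hf : HasDerivAt (fun y : ℝ ↦ (y ^ 2 + 9 / 4) / (y ^ 2 + 1 / 4))
      ((2 * y * (y ^ 2 + 1 / 4) - (y ^ 2 + 9 / 4) * (2 * y)) / (y ^ 2 + 1 / 4) ^ 2) y := by
    have hd9 : HasDerivAt (fun y : ℝ ↦ y ^ 2 + 9 / 4) (2 * y) y := by
      simpa using ((hasDerivAt_pow 2 y).add_const (9 / 4 : ℝ))
    have hd4 : HasDerivAt (fun y : ℝ ↦ y ^ 2 + 1 / 4) (2 * y) y := by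
      simpa using ((hasDerivAt_pow 2 y).add_const (1 / 4 : ℝ))
    exact hd9.div hd4 h4.ne'
  have h := (hf.log (div_pos h9 h4).ne').const_mul (1 / 2 : ℝ)
  refine h.congr_deriv ?_
  rw [Qd]
  field_simp
  ring

/-- `g' = −(2ny/Q) g`. -/
theorem hasDerivAt_gA (n : ℕ) (y : ℝ) : HasDerivAt (gA n) (-(2 * n * y / Qd y) * gA n y) y := by
  have h := (((hasDerivAt_ha y).const_mul (n : ℝ)).exp).const_mul kap
  refine h.congr_deriv ?_
  rw [gA]
  ring

/-- `P' = n u − log 2`. -/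
theorem hasDerivAt_Ph (n : ℕ) (y : ℝ) : HasDerivAt (Ph n) (n * ua y - Real.log 2) y := by
  have h := (((hasDerivAt_id' y).const_mul (Real.log 2)).neg).sub ((hasDerivAt_bq y).const_mul (n : ℝ))
  refine h.congr_deriv ?_
  ring

/-- `P'' = n u₁`, as a derivative of `y ↦ n u(y) − log 2`. -/
theorem hasDerivAt_Ph' (n : ℕ) (y : ℝ) : HasDerivAt (fun y ↦ n * ua y - Real.log 2) (n * ub y) y := by
  simpa using ((hasDerivAt_ua y).const_mul (n : ℝ)).sub_const (Real.log 2)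

/-- `P''' = n u₂`. -/
theorem hasDerivAt_Ph'' (n : ℕ) (y : ℝ) : HasDerivAt (fun y ↦ n * ub y) (n * uc y) y :=
  (hasDerivAt_ub y).const_mul (n : ℝ)

/-- `u` is continuous. -/
theorem continuous_ua : Continuous ua := by
  unfold ua
  exact (continuous_const.div (by fun_prop) fun y ↦ by positivity).sub
    (continuous_const.div (by fun_prop) fun y ↦ by positivity)

/-- `g'` is continuous. -/
theorem continuous_gA' (n : ℕ) : Continuous fun y ↦ -(2 * n * y / Qd y) * gA n y := by
  have hQ : Continuous Qd := by unfold Qd; fun_prop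
  have hh : Continuous ha := by
    unfold ha
    refine continuous_const.mul ((Real.continuousOn_log.comp_continuous
      ((by fun_prop : Continuous fun y : ℝ ↦ y ^ 2 + 9 / 4).div (by fun_prop) fun y ↦ by positivity)
      fun y ↦ ?_))
    simp only [Set.mem_compl_iff, Set.mem_singleton_iff]
    positivity
  have hg : Continuous (gA n) := by unfold gA; fun_prop
  exact ((by fun_prop : Continuous fun y : ℝ ↦ 2 * (n : ℝ) * y).div hQ fun y ↦ (Qd_pos y).ne').neg.mul hg

end PrimeEdge

end Summit.RiemannHypothesis.RiemannHypothesis.Theorems.LiTheory
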